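import Mathlib

/-!
# PneNP / OverlapGapAlgebra — crux `SolvableImpliesStableSection` (stmt-PneNP-2463):
# the TWO-WAY REPAIR block (8/·) — reversing, extending and concatenating clause-walks

Support for crux `stmt-PneNP-2463` (`Summit.PneNP.PneNP.Theses.OverlapGapAlgebra.SolvableImpliesStableSection`):
the f-free block "bounded-round two-way repair with one-round memory gives stable sections for every
`ν > 0` up to `α ≤ 2^k/(4k)`".  Sign-free versions of the walk operations of `…MonotoneRepairWalkOps`:
a clause-walk `w, u, o` of length `P` in `Φ` has the step equations `var(w (d+1), u (d+1)) =
var(w d, o d)`; it is NON-DEGENERATE when the in-slot and the out-slot differ at the inner clauses and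
consecutive equal clauses use different slots (the two hypotheses of the bad-walk extraction
`sissR_walk_extract` / `sissR_walk_closed`).  In the two-way witness trees these come from "a
child-bearing slot is not childless" and from the alternation of signs along an edge, no longer from a
global sign pattern; so the operations are restated with the non-degeneracy conditions as hypotheses:

* `sissW_walk_rev` — reversal of a walk, with a prescribed final out-slot;
* `sissW_walk_append` — appending one clause with prescribed in- and out-slots;
* `sissW_walk_concat` — concatenation through an "across" equation.
No definitions; axioms `propext`, `Classical.choice`, `Quot.sound`.
-/

set_option linter.dupNamespace false -- `Summit.PneNP.PneNP.…`: summit = sub-problem (D-0017)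

namespace Summit.PneNP.PneNP.Theorems

open Finset
open scoped Classical

section WalkOps

variable {m k n : ℕ}

/-- **Reversal.** A non-degenerate clause-walk `w, u, o` of length `P` reversed — `W i = w (P - i)`,
in-slots `o`, out-slots `u`, final out-slot `j₁ ≠ o 0` (when `P ≥ 1`) — is a non-degenerate
clause-walk of length `P` from `w P` to `w 0`. -/
theorem sissW_walk_rev (Φ : (Fin m → Fin k → Fin n × Bool)) (P : ℕ) (w : ℕ → Fin m) (u o : ℕ → Fin k)
    (hsteps : ∀ d, d < P → (Φ (w (d + 1)) (u (d + 1))).1 = (Φ (w d) (o d)).1)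
    (hio : ∀ i, 1 ≤ i → i < P → u i ≠ o i)
    (hsep : ∀ d, d < P → w (d + 1) = w d → u (d + 1) ≠ o d)
    (j₁ : Fin k) (hj₁ : 1 ≤ P → j₁ ≠ o 0) :
    ∃ (W : ℕ → Fin m) (U O : ℕ → Fin k), W 0 = w P ∧ W P = w 0 ∧ O P = j₁ ∧
      (∀ d, d < P → (Φ (W (d + 1)) (U (d + 1))).1 = (Φ (W d) (O d)).1) ∧
      (∀ i, 1 ≤ i → i ≤ P → U i ≠ O i) ∧
      (∀ d, d < P → W (d + 1) = W d → U (d + 1) ≠ O d) := by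
  refine ⟨fun i => w (P - i), fun i => o (P - i), fun i => if i = P then j₁ else u (P - i),
    by simp, by simp, by simp, ?_, ?_, ?_⟩
  · intro d hd
    have hdP : d ≠ P := by omega
    simp only [hdP, if_false]
    have h1 : P - d = P - (d + 1) + 1 := by omega
    have := hsteps (P - (d + 1)) (by omega)
    rw [← h1] at this
    exact this.symm
  · intro i h1 h2
    by_cases hiP : i = P
    · subst hiP
      simp only [if_true, Nat.sub_self]
      exact fun h => hj₁ h1 h.symm
    · simp only [hiP, if_false]
      exact fun h => hio (P - i) (by omega) (by omega) h.symm
  · intro d hd hWW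
    have hdP : d ≠ P := by omega
    simp only [hdP, if_false]
    have h1 : P - d = P - (d + 1) + 1 := by omega
    intro hcon
    have := hsep (P - (d + 1)) (by omega) (by rw [← h1]; exact hWW.symm)
    rw [← h1] at this
    exact this hcon.symm

/-- **Appending one clause.** A non-degenerate clause-walk `W, U, O` of length `P` with final out-slot
`O P`, extended by a clause `x` entered at slot `jin` (`var(x, jin) = var(W P, O P)`) and left at
`jout ≠ jin`, where `jin ≠ O P` if `x = W P`, is a non-degenerate clause-walk of length `P + 1`. -/
theorem sissW_walk_append (Φ : (Fin m → Fin k → Fin n × Bool)) (P : ℕ) (W : ℕ → Fin m) (U O : ℕ → Fin k)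
    (hsteps : ∀ d, d < P → (Φ (W (d + 1)) (U (d + 1))).1 = (Φ (W d) (O d)).1)
    (hio : ∀ i, 1 ≤ i → i ≤ P → U i ≠ O i)
    (hsep : ∀ d, d < P → W (d + 1) = W d → U (d + 1) ≠ O d)
    (x : Fin m) (jin jout : Fin k) (hstep : (Φ x jin).1 = (Φ (W P) (O P)).1) (hjj : jin ≠ jout)
    (hjunc : x = W P → jin ≠ O P) :
    ∃ (W' : ℕ → Fin m) (U' O' : ℕ → Fin k), (∀ i, i ≤ P → W' i = W i) ∧ W' (P + 1) = x ∧
      O' (P + 1) = jout ∧ U' (P + 1) = jin ∧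
      (∀ d, d < P + 1 → (Φ (W' (d + 1)) (U' (d + 1))).1 = (Φ (W' d) (O' d)).1) ∧
      (∀ i, 1 ≤ i → i ≤ P + 1 → U' i ≠ O' i) ∧
      (∀ d, d < P + 1 → W' (d + 1) = W' d → U' (d + 1) ≠ O' d) := by
  have hP : ¬ P + 1 ≤ P := by omega
  refine ⟨fun i => if i ≤ P then W i else x, fun i => if i ≤ P then U i else jin,
    fun i => if i ≤ P then O i else jout, fun i hi => by simp [hi], by simp, by simp, by simp, ?_, ?_, ?_⟩
  · intro d hd
    rcases Nat.lt_or_ge d P with h | h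
    · have h1 : d + 1 ≤ P := h
      simp only [h1, h.le, if_true]
      exact hsteps d h
    · have hd' : d = P := by omega
      subst hd'
      simp only [hP, if_false, le_refl, if_true]
      exact hstep
  · intro i h1 h2
    rcases Nat.lt_or_ge i (P + 1) with h | h
    · have hi : i ≤ P := by omega
      simp only [hi, if_true]
      exact hio i h1 hi
    · have hi : i = P + 1 := by omega
      subst hi
      simp only [hP, if_false]
      exact hjj
  · intro d hd
    rcases Nat.lt_or_ge d P with h | h
    · have h1 : d + 1 ≤ P := h
      simp only [h1, h.le, if_true]
      exact hsep d h
    · have hd' : d = P := by omega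
      subst hd'
      simp only [hP, if_false, le_refl, if_true]
      exact hjunc

/-- **Concatenation through an across equation.** Let `W₁, U₁, O₁` be a non-degenerate clause-walk of
length `P₁` with a final out-slot `O₁ P₁`, and `w₂, u₂, o₂` one of length `P₂`, non-degenerate at its
inner clauses; let `j₂` be a slot of `w₂ 0` with `var(w₂ 0, j₂) = var(W₁ P₁, O₁ P₁)`, `j₂ ≠ o₂ 0`
when `P₂ ≥ 1`, and `j₂ ≠ O₁ P₁` when `w₂ 0 = W₁ P₁`. Then the concatenated sequence is a
non-degenerate clause-walk of length `P₁ + 1 + P₂` from `W₁ 0` to `w₂ P₂`. -/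
theorem sissW_walk_concat (Φ : (Fin m → Fin k → Fin n × Bool)) (P₁ : ℕ) (W₁ : ℕ → Fin m) (U₁ O₁ : ℕ → Fin k)
    (hsteps₁ : ∀ d, d < P₁ → (Φ (W₁ (d + 1)) (U₁ (d + 1))).1 = (Φ (W₁ d) (O₁ d)).1)
    (hio₁ : ∀ i, 1 ≤ i → i ≤ P₁ → U₁ i ≠ O₁ i)
    (hsep₁ : ∀ d, d < P₁ → W₁ (d + 1) = W₁ d → U₁ (d + 1) ≠ O₁ d)
    (P₂ : ℕ) (w₂ : ℕ → Fin m) (u₂ o₂ : ℕ → Fin k)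
    (hsteps₂ : ∀ d, d < P₂ → (Φ (w₂ (d + 1)) (u₂ (d + 1))).1 = (Φ (w₂ d) (o₂ d)).1)
    (hio₂ : ∀ i, 1 ≤ i → i < P₂ → u₂ i ≠ o₂ i)
    (hsep₂ : ∀ d, d < P₂ → w₂ (d + 1) = w₂ d → u₂ (d + 1) ≠ o₂ d)
    (j₂ : Fin k) (hacross : (Φ (w₂ 0) j₂).1 = (Φ (W₁ P₁) (O₁ P₁)).1)
    (hj₂o : 1 ≤ P₂ → j₂ ≠ o₂ 0) (hjunc : w₂ 0 = W₁ P₁ → j₂ ≠ O₁ P₁) :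
    ∃ (W : ℕ → Fin m) (U O : ℕ → Fin k), W 0 = W₁ 0 ∧ W (P₁ + 1 + P₂) = w₂ P₂ ∧
      (∀ d, d < P₁ + 1 + P₂ → (Φ (W (d + 1)) (U (d + 1))).1 = (Φ (W d) (O d)).1) ∧
      (∀ i, 1 ≤ i → i ≤ P₁ + P₂ → U i ≠ O i) ∧
      (∀ d, d < P₁ + 1 + P₂ → W (d + 1) = W d → U (d + 1) ≠ O d) := by
  set W : ℕ → Fin m := fun i => if i ≤ P₁ then W₁ i else w₂ (i - (P₁ + 1)) with hW
  set U : ℕ → Fin k := fun i => if i ≤ P₁ then U₁ i else if i = P₁ + 1 then j₂ else u₂ (i - (P₁ + 1))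
    with hU
  set O : ℕ → Fin k := fun i => if i ≤ P₁ then O₁ i else o₂ (i - (P₁ + 1)) with hO
  refine ⟨W, U, O, by simp [hW], ?_, ?_, ?_, ?_⟩
  · have h : ¬ P₁ + 1 + P₂ ≤ P₁ := by omega
    simp only [hW, h, if_false]
    congr 1
    omega
  · -- the step equations
    intro d hd
    rcases Nat.lt_trichotomy d P₁ with h | h | h
    · have h1 : d ≤ P₁ := h.le
      have h2 : d + 1 ≤ P₁ := h
      simp only [hW, hU, hO, h1, h2, if_true]
      exact hsteps₁ d h
    · subst h
      have h1 : ¬ d + 1 ≤ d := by omega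
      simp only [hW, hU, hO, h1, if_false, le_refl, if_true, Nat.sub_self]
      exact hacross
    · have h1 : ¬ d ≤ P₁ := by omega
      have h2 : ¬ d + 1 ≤ P₁ := by omega
      have h3 : d + 1 ≠ P₁ + 1 := by omega
      simp only [hW, hU, hO, h1, h2, h3, if_false]
      have h4 : d + 1 - (P₁ + 1) = d - (P₁ + 1) + 1 := by omega
      rw [h4]
      exact hsteps₂ (d - (P₁ + 1)) (by omega)
  · -- in-slot ≠ out-slot at the inner clauses
    intro i h1 h2
    rcases Nat.lt_trichotomy i (P₁ + 1) with h | h | h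
    · have hi : i ≤ P₁ := by omega
      simp only [hU, hO, hi, if_true]
      exact hio₁ i h1 hi
    · subst h
      have hi : ¬ P₁ + 1 ≤ P₁ := by omega
      simp only [hU, hO, hi, if_false, if_true, Nat.sub_self]
      exact hj₂o (by omega)
    · have hi : ¬ i ≤ P₁ := by omega
      have hi1 : i ≠ P₁ + 1 := by omega
      simp only [hU, hO, hi, hi1, if_false]
      exact hio₂ (i - (P₁ + 1)) (by omega) (by omega)
  · -- consecutive equal clauses use different slots
    intro d hd hWW
    rcases Nat.lt_trichotomy d P₁ with h | h | h
    · have h1 : d ≤ P₁ := h.le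
      have h2 : d + 1 ≤ P₁ := h
      simp only [hW, h1, h2, if_true] at hWW
      simp only [hU, hO, h1, h2, if_true]
      exact hsep₁ d h hWW
    · subst h
      have h1 : ¬ d + 1 ≤ d := by omega
      simp only [hW, h1, if_false, le_refl, if_true, Nat.sub_self] at hWW
      simp only [hU, hO, h1, if_false, le_refl, if_true]
      exact hjunc hWW
    · have h1 : ¬ d ≤ P₁ := by omega
      have h2 : ¬ d + 1 ≤ P₁ := by omega
      have h3 : d + 1 ≠ P₁ + 1 := by omega
      simp only [hW, h1, h2, if_false] at hWW
      simp only [hU, hO, h1, h2, h3, if_false]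
      have h4 : d + 1 - (P₁ + 1) = d - (P₁ + 1) + 1 := by omega
      rw [h4] at hWW ⊢
      exact hsep₂ (d - (P₁ + 1)) (by omega) hWW

end WalkOps

end Summit.PneNP.PneNP.Theorems
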